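import Literature.NumberTheory.EllipticCurves.FormalGroupXDerivativeProofs
import Mathlib.RingTheory.Ideal.Quotient.Operations
import HarnessLib

/-!
# The Frobenius model of the universal ordinary `a₁`-chart at `p = 2`, I: the CLOSED-FORM series identities
# (step S3 of the discharge plan for the PRINT stub `stub_sigmaSqTwo` of crux C3′; route-independent, any commutative ring)

Cell `bsd-f1-sign2`, WIDTH-5 attach seat `bsd-line-att-p3` g9 (`--supports stmt-BirchSwinnertonDyer-23008`; plan
`Cruxes/BSDOfMainConjectureRankOneAtTwo/SIGMASQ-AT-TWO-att-p3.md` §8 (S3.4)). THEOREMS ONLY; pure power-series algebra over an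
ARBITRARY commutative ring `K`. BSD is not proved by any of this.

SETTING. `V = ⟨1, B₂, 0, 0, B₆⟩` an `a₁`-chart curve whose canonical `2`-torsion abscissa is RATIONALLY PARAMETRISED: for elements
`X₀, B₂, g₂` with `X₀ = −1 − 4B₂ − 64g₂` and `B₆ = g₂X₀²` (equivalently `g₂ = B₆/X₀²` and `X₀³ + (1 + 4B₂)X₀² + 64B₆ = 0`: `X₀ = 4x(Q)`,
`Q = (X₀/4, −X₀/8)` the generator of the canonical subgroup), write `Xs = z²x(z)` (`formalXMulSq`) and put
* `𝒜 = 4Xs − X₀z²` (`= 4z²(x − x(Q))`), `𝒬 = Xs² − 16g₂·Xs·z² − 4g₂X₀·z⁴` (a UNIT series),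
* `𝒰 = Xs² − 8δ·Xs·z² + 2c₁z⁴`, `c₁ = δX₀ − 4g₂X₀` (`= z⁴·u₂²(4x − X₀)·x″`, `x″` the abscissa of the Frobenius model, `4r = R₁ = −X₀ + 32δ`),
* `𝒢`, `𝔇 = (1 + 2B₂)·z·Xs·𝒰 + Xs²𝒬 + 8g₂X₀·z⁴𝒬 − z²Xs𝒢` (a UNIT series), `ℳ = 4Xs𝒜 + t₁₆z⁴` (`t₁₆ = 16t = 3X₀² + 8B₂X₀ + 2X₀`),
  `ℰ₀ = 128·E₁` (the denominator of the isogeny parameter `T = θ_vc(τ)` of the Frobenius model `vc = [2(1 + 2B₂); R₁/4, 2B₂ + ½, −R₁/8]`,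
  see `…SigmaSqTwoFrobeniusModel.lean`), `𝔇₁ = ℰ₀/64`.
Here `δ` is a free parameter in §1 (the identities hold for every `δ`); in §2 `δ = −(1 + 4ν)g₂` (the rational parametrisation of the
Hensel root `R₁` of `3R₁² + (8B₂ + 2)R₁ − 5t₁₆ = 0`, `…SigmaSqTwoFrobeniusParam.lean`).

§1 (exact identities, any `δ`): `frob_cM_sub_eq` (`ℳ − R₁z²𝒜 = 16𝒰`), `frob_E0_eq` (`ℰ₀ = 64𝔇₁`), `frob_calQ_mul_D1` (`𝒬𝔇₁ = (2 − z)Xs𝔇`),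
**`frob_calA_mul_calQ` (`𝒜·𝒬 = (2 − z)²·Xs²` — the DOUBLE zero of `x − x(Q)` at `z(Q) = 2`, which is EXACTLY `2` because `2y + x = 0` on
`E[2]` for the `a₁`-chart)**. Consequence (next file): `T = (1 + 2B₂)·z(2 − z)·Xs·𝒰/𝔇` and `V = 𝔇²/(𝒬𝒰²)` — manifestly integral.
§2 (congruences, `δ = −(1 + 4ν)g₂`): modulo `2`, `𝒰 ≡ 𝒬 ≡ Xs²`, `𝔇 ≡ Xs³` (`frob_map_calU/calQ/calD`), hence
**`T ≡ z²` (`frob_coeff_N2_sub_mem`) and `V ≡ 1` (`frob_coeff_calD_sq_sub_mem`) — the hypotheses `hφ`, `hu` of the tree's Dwork lemma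
`Literature.RingTheory.FormalGroups.coeff_mem_of_map_subst_eq_pow_mul`.** All certificates were found with a hand-rolled eliminator
(curve equation `Xs² = Xs³ + zXs² + B₂z²Xs² + B₆z⁶`, then `X₀`, then `δ`) and are checked by `linear_combination`.

## Sources
J. Vélu, C. R. Acad. Sci. Paris 273 (1971) [cite: SilvermanAEC2009, III.4]; C. Blakestad, D. Grant, J. Number Theory 249 (2023), Prop. 7 (c),
Lemma 12 (`t_p ≡ tᵖ`, `u ≡ 1 (mod p)` for the canonical quotient) [cite: BlakestadGrant2023, Prop. 7]; N. M. Katz, LNM 350 (1973) §3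
(quotient by the canonical subgroup lifts Frobenius) [cite: MazurTate1991, Thm. 3.1].
-/

noncomputable section

set_option linter.dupNamespace false
set_option autoImplicit false

open scoped Classical
open PowerSeries WeierstrassCurve

namespace Summit.BirchSwinnertonDyer.BirchSwinnertonDyer.Theorems.AlignedTransportAtTwoSigmaSqTwo

section FrobeniusSeries

variable {K : Type*} [CommRing K] (V : WeierstrassCurve K) {X0 B2 g2 d nu : K}
  {cA cU cQ cG cD cM E0 D1 : K⟦X⟧}

/-- The cleared Weierstrass equation of the formal point of the chart curve `⟨1, B₂, 0, 0, g₂X₀²⟩`: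
`Xs² = Xs³ + zXs² + B₂z²Xs² + g₂X₀²z⁶`. [cite: SilvermanAEC2009, IV.1.1] -/
theorem frob_curve_eq (h1 : V.a₁ = 1) (h2 : V.a₂ = B2) (h3 : V.a₃ = 0) (h4 : V.a₄ = 0) (h6 : V.a₆ = g2 * X0 ^ 2) :
    V.formalXMulSq ^ 2 = V.formalXMulSq ^ 3 + X * V.formalXMulSq ^ 2 + C B2 * X ^ 2 * V.formalXMulSq ^ 2 +
      C g2 * C X0 ^ 2 * X ^ 6 := by
  have h := V.formalXMulSq_sq_eq
  rw [h1, h2, h3, h4, h6] at h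
  simp only [map_one, map_zero, map_mul, map_pow, one_mul, zero_mul, add_zero] at h
  linear_combination h

/-- `X₀ = −1 − 4B₂ − 64g₂` read in `K⟦z⟧`. [folklore] -/
theorem frob_C_X0 (hX0 : X0 = -1 - 4 * B2 - 64 * g2) : (C X0 : K⟦X⟧) = -1 - 4 * C B2 - 64 * C g2 := by
  rw [hX0]; simp only [map_sub, map_neg, map_mul, map_one, map_ofNat]

/-! ## §1 Exact identities (any `δ`) -/

/-- **`ℳ − R₁z²𝒜 = 16·𝒰`** (`R₁ = −X₀ + 32δ`): the numerator `16x² − 4(X₀ + R₁)x + (t₁₆ + R₁X₀)` of `4u₂²x″·(4x − X₀)` is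
`16(x² − 8δx + 2c₁)` because `X₀ + R₁ = 32δ` and `t₁₆ + R₁X₀ = 32c₁` (the cubic of `X₀`). [cite: SilvermanAEC2009, III.4] -/
theorem frob_cM_sub_eq (hX0 : X0 = -1 - 4 * B2 - 64 * g2) (hA : cA = 4 * V.formalXMulSq - C X0 * X ^ 2)
    (hU : cU = V.formalXMulSq ^ 2 - 8 * C d * V.formalXMulSq * X ^ 2 + 2 * (C d * C X0 - 4 * C g2 * C X0) * X ^ 4)
    (hM : cM = 4 * V.formalXMulSq * cA + (3 * C X0 ^ 2 + 8 * C B2 * C X0 + 2 * C X0) * X ^ 4) :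
    cM - (-C X0 + 32 * C d) * X ^ 2 * cA = 16 * cU := by
  have hX0C := frob_C_X0 (K := K) hX0
  set Xs := V.formalXMulSq with hXs
  subst hA hU hM
  linear_combination ((2 : K⟦X⟧) * X ^ 4 * C X0) * hX0C

/-- **`ℰ₀ = 64·𝔇₁`**: the denominator `ℰ₀ = 128·(Dn + s·zAM + (t − sr)z³A²)` of `T = θ_vc(τ)` for `vc = [2u₂; r, u₂ − ½, −r/2]`,
`u₂ = 1 + 2B₂`, is `64` times a series with constant term `2`. [cite: BlakestadGrant2023, Prop. 7] -/
theorem frob_E0_eq (h1 : V.a₁ = 1) (h2 : V.a₂ = B2) (h3 : V.a₃ = 0) (h4 : V.a₄ = 0) (h6 : V.a₆ = g2 * X0 ^ 2)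
    (hX0 : X0 = -1 - 4 * B2 - 64 * g2) (hA : cA = 4 * V.formalXMulSq - C X0 * X ^ 2)
    (hM : cM = 4 * V.formalXMulSq * cA + (3 * C X0 ^ 2 + 8 * C B2 * C X0 + 2 * C X0) * X ^ 4)
    (hE0 : E0 = 8 * V.formalXMulSq * cA ^ 2 + (3 * C X0 ^ 2 + 8 * C B2 * C X0 + 2 * C X0) * X ^ 4 *
        (2 * X * cA - 8 * V.formalXMulSq + C X0 * X ^ 3) + (1 + 4 * C B2) * X * cA * cM -
        2 * (1 + 2 * C B2) * (-C X0 + 32 * C d) * X ^ 3 * cA ^ 2)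
    (hD1 : D1 = V.formalXMulSq ^ 3 * (2 + (1 + 4 * C B2) * X) - C X0 * V.formalXMulSq ^ 2 * X ^ 2 -
        (C B2 * C X0 + 16 * (1 + 2 * C B2) * C d) * V.formalXMulSq ^ 2 * X ^ 3 + 16 * C g2 * C X0 * V.formalXMulSq * X ^ 4 +
        (4 * (C d * C X0 - 4 * C g2 * C X0) + (1 + 4 * C B2) * (2 * C d * C X0 + 2 * (C d * C X0 - 4 * C g2 * C X0))) *
          V.formalXMulSq * X ^ 5 - (1 + 2 * C B2) * (C d * C X0 - 4 * C g2 * C X0) * C X0 * X ^ 7) :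
    E0 = 64 * D1 := by
  have hcurve := frob_curve_eq V h1 h2 h3 h4 h6
  have hX0C := frob_C_X0 (K := K) hX0
  set Xs := V.formalXMulSq with hXs
  subst hA hM hE0 hD1
  linear_combination ((-8 : K⟦X⟧) * X ^ 7 * C X0 ^ 2 * C B2 + (-4 : K⟦X⟧) * X ^ 7 * C X0 ^ 2 + (32 : K⟦X⟧) * Xs * X ^ 5 * C X0 * C B2 + (24 : K⟦X⟧) * Xs * X ^ 5 * C X0 + (-16 : K⟦X⟧) * Xs * X ^ 4 * C X0) * hX0C

/-- **`𝒬·𝔇₁ = (2 − z)·Xs·𝔇`** — the passage from the `64`-cleared denominator to the UNIT denominator `𝔇`.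
[cite: BlakestadGrant2023, Prop. 7] -/
theorem frob_calQ_mul_D1 (h1 : V.a₁ = 1) (h2 : V.a₂ = B2) (h3 : V.a₃ = 0) (h4 : V.a₄ = 0) (h6 : V.a₆ = g2 * X0 ^ 2)
    (hX0 : X0 = -1 - 4 * B2 - 64 * g2)
    (hU : cU = V.formalXMulSq ^ 2 - 8 * C d * V.formalXMulSq * X ^ 2 + 2 * (C d * C X0 - 4 * C g2 * C X0) * X ^ 4)
    (hQ : cQ = V.formalXMulSq ^ 2 - 16 * C g2 * V.formalXMulSq * X ^ 2 - 4 * C g2 * C X0 * X ^ 4)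
    (hG : cG = (-C B2 - 32 * C g2) * V.formalXMulSq ^ 2 - 4 * (1 + 2 * C B2) * C d * V.formalXMulSq * X ^ 2 +
        (1 + 2 * C B2) * (C d * C X0 - 4 * C g2 * C X0) * X ^ 4 - 8 * C g2 * C X0 * V.formalXMulSq * X ^ 2 -
        2 * C g2 * C X0 ^ 2 * X ^ 4)
    (hD : cD = (1 + 2 * C B2) * X * V.formalXMulSq * cU + V.formalXMulSq ^ 2 * cQ + 8 * C g2 * C X0 * X ^ 4 * cQ -
        X ^ 2 * V.formalXMulSq * cG)
    (hD1 : D1 = V.formalXMulSq ^ 3 * (2 + (1 + 4 * C B2) * X) - C X0 * V.formalXMulSq ^ 2 * X ^ 2 -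
        (C B2 * C X0 + 16 * (1 + 2 * C B2) * C d) * V.formalXMulSq ^ 2 * X ^ 3 + 16 * C g2 * C X0 * V.formalXMulSq * X ^ 4 +
        (4 * (C d * C X0 - 4 * C g2 * C X0) + (1 + 4 * C B2) * (2 * C d * C X0 + 2 * (C d * C X0 - 4 * C g2 * C X0))) *
          V.formalXMulSq * X ^ 5 - (1 + 2 * C B2) * (C d * C X0 - 4 * C g2 * C X0) * C X0 * X ^ 7) :
    cQ * D1 = (2 - X) * V.formalXMulSq * cD := by
  have hcurve := frob_curve_eq V h1 h2 h3 h4 h6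
  have hX0C := frob_C_X0 (K := K) hX0
  set Xs := V.formalXMulSq with hXs
  subst hU hQ hG hD hD1
  linear_combination ((-512 : K⟦X⟧) * X ^ 5 * C B2 * C g2 * C d + (-32 : K⟦X⟧) * X ^ 5 * C B2 ^ 2 * C d + (-64 : K⟦X⟧) * X ^ 5 * C B2 ^ 2 * C g2 + (-4 : K⟦X⟧) * X ^ 5 * C B2 ^ 3 + (-16 : K⟦X⟧) * X ^ 5 * C X0 * C B2 * C d + (32 : K⟦X⟧) * X ^ 5 * C X0 * C B2 * C g2 + (-1 : K⟦X⟧) * X ^ 5 * C X0 * C B2 ^ 2 + (-256 : K⟦X⟧) * X ^ 5 * C g2 * C d + (-24 : K⟦X⟧) * X ^ 5 * C B2 * C d + (-1 : K⟦X⟧) * X ^ 5 * C B2 ^ 2 + (-8 : K⟦X⟧) * X ^ 5 * C X0 * C d + (16 : K⟦X⟧) * X ^ 5 * C X0 * C g2 + (-128 : K⟦X⟧) * X ^ 4 * C B2 * C g2 + (-8 : K⟦X⟧) * X ^ 4 * C B2 ^ 2 + (-2 : K⟦X⟧) * X ^ 4 * C X0 * C B2 + (-4 : K⟦X⟧) *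 X ^ 5 * C d + (32 : K⟦X⟧) * Xs * X ^ 3 * C B2 * C d + (64 : K⟦X⟧) * Xs * X ^ 3 * C B2 * C g2 + (4 : K⟦X⟧) * Xs * X ^ 3 * C B2 ^ 2 + Xs * X ^ 3 * C X0 * C B2 + (64 : K⟦X⟧) * X ^ 3 * C B2 * C g2 + (4 : K⟦X⟧) * X ^ 3 * C B2 ^ 2 + X ^ 3 * C X0 * C B2 + (-2 : K⟦X⟧) * X ^ 4 * C B2 + (16 : K⟦X⟧) * Xs * X ^ 3 * C d + Xs * X ^ 3 * C B2 + (-64 : K⟦X⟧) * X ^ 3 * C g2 + (-3 : K⟦X⟧) * X ^ 3 * C B2 + (-1 : K⟦X⟧) * X ^ 3 * C X0 + (64 : K⟦X⟧) * Xs * X ^ 2 * C g2 + (4 : K⟦X⟧) * Xs * X ^ 2 * C B2 + Xs * X ^ 2 * C X0 + (-4 : K⟦X⟧) * Xs ^ 2 * X * C B2 + (64 : K⟦X⟧) * X ^ 2 * C g2 + (4 : K⟦X⟧) * X ^ 2 * C B2 + X ^ 2 * C X0 + (-1 : K⟦X⟧) * X ^ 3 + Xs * X ^ 2 + (-2 :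 K⟦X⟧) * Xs ^ 2 * X + X ^ 2) * hcurve + ((-8 : K⟦X⟧) * X ^ 11 * C X0 ^ 2 * C B2 * C g2 * C d + (-1 : K⟦X⟧) * X ^ 11 * C X0 ^ 2 * C B2 ^ 2 * C g2 + (-4 : K⟦X⟧) * X ^ 11 * C X0 ^ 2 * C g2 * C d + (-2 : K⟦X⟧) * X ^ 10 * C X0 ^ 2 * C B2 * C g2 + Xs * X ^ 9 * C X0 ^ 2 * C B2 * C g2 + X ^ 9 * C X0 ^ 2 * C B2 * C g2 + (-1 : K⟦X⟧) * X ^ 9 * C X0 ^ 2 * C g2 + Xs * X ^ 8 * C X0 ^ 2 * C g2 + (-8 : K⟦X⟧) * Xs ^ 2 * X ^ 7 * C B2 ^ 2 * C d + (-1 : K⟦X⟧) * Xs ^ 2 * X ^ 7 * C B2 ^ 3 + (-2 : K⟦X⟧) * Xs ^ 2 * X ^ 7 * C X0 * C B2 * C d + (8 : K⟦X⟧) * Xs ^ 2 * X ^ 7 * C X0 * C B2 * C g2 + X ^ 8 * C X0 ^ 2 * C g2 + (-4 : K⟦X⟧) * Xs ^ 2 * X ^ 7 * C B2 * C d + (-1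 : K⟦X⟧) * Xs ^ 2 * X ^ 7 * C X0 * C d + (4 : K⟦X⟧) * Xs ^ 2 * X ^ 7 * C X0 * C g2 + (-8 : K⟦X⟧) * Xs ^ 2 * X ^ 6 * C B2 * C d + (-3 : K⟦X⟧) * Xs ^ 2 * X ^ 6 * C B2 ^ 2 + (8 : K⟦X⟧) * Xs ^ 2 * X ^ 5 * C B2 * C d + (2 : K⟦X⟧) * Xs ^ 2 * X ^ 5 * C B2 ^ 2 + (-4 : K⟦X⟧) * Xs ^ 2 * X ^ 6 * C d + (4 : K⟦X⟧) * Xs ^ 2 * X ^ 5 * C d + (-3 : K⟦X⟧) * Xs ^ 2 * X ^ 5 * C B2 + (4 : K⟦X⟧) * Xs ^ 2 * X ^ 4 * C B2 + (-1 : K⟦X⟧) * Xs ^ 2 * X ^ 3 * C B2 + (-1 : K⟦X⟧) * Xs ^ 2 * X ^ 4 + (2 : K⟦X⟧) * Xs ^ 2 * X ^ 3 + (-1 : K⟦X⟧) * Xs ^ 2 * X ^ 2) * hX0C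

/-- **`𝒜·𝒬 = (2 − z)²·Xs²`**: `η² = 4x³ + b₂x² + b₆ = 4(x − e)·q₁(x)` with `η = 2y + x = Xs·(z − 2)/z³`, `e = X₀/4`,
`q₁ = x² − 16g₂x − 4g₂X₀` — the double zero of `x − x(Q)` at `Q ∈ E[2]`, located at `z(Q) = −x(Q)/y(Q) = 2` EXACTLY.
[cite: SilvermanAEC2009, III.4] -/
theorem frob_calA_mul_calQ (h1 : V.a₁ = 1) (h2 : V.a₂ = B2) (h3 : V.a₃ = 0) (h4 : V.a₄ = 0) (h6 : V.a₆ = g2 * X0 ^ 2)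
    (hX0 : X0 = -1 - 4 * B2 - 64 * g2) (hA : cA = 4 * V.formalXMulSq - C X0 * X ^ 2)
    (hQ : cQ = V.formalXMulSq ^ 2 - 16 * C g2 * V.formalXMulSq * X ^ 2 - 4 * C g2 * C X0 * X ^ 4) :
    cA * cQ = (2 - X) ^ 2 * V.formalXMulSq ^ 2 := by
  have hcurve := frob_curve_eq V h1 h2 h3 h4 h6
  have hX0C := frob_C_X0 (K := K) hX0
  set Xs := V.formalXMulSq with hXs
  subst hA hQ
  linear_combination ((-4 : K⟦X⟧)) * hcurve + ((-1 : K⟦X⟧) * Xs ^ 2 * X ^ 2) * hX0C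

/-- Constant terms: `𝒰(0) = 𝒬(0) = 𝔇(0) = 1` (so `𝒬`, `𝔇` are units of `K⟦z⟧`). [folklore] -/
theorem frob_constantCoeff
    (hU : cU = V.formalXMulSq ^ 2 - 8 * C d * V.formalXMulSq * X ^ 2 + 2 * (C d * C X0 - 4 * C g2 * C X0) * X ^ 4)
    (hQ : cQ = V.formalXMulSq ^ 2 - 16 * C g2 * V.formalXMulSq * X ^ 2 - 4 * C g2 * C X0 * X ^ 4)
    (hD : cD = (1 + 2 * C B2) * X * V.formalXMulSq * cU + V.formalXMulSq ^ 2 * cQ + 8 * C g2 * C X0 * X ^ 4 * cQ -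
        X ^ 2 * V.formalXMulSq * cG) :
    constantCoeff cU = 1 ∧ constantCoeff cQ = 1 ∧ constantCoeff cD = 1 := by
  have hX : constantCoeff (X : K⟦X⟧) = 0 := constantCoeff_X
  have hXs0 := V.constantCoeff_formalXMulSq
  have hU0 : constantCoeff cU = 1 := by
    rw [hU]; simp only [map_add, map_sub, map_mul, map_pow, constantCoeff_C, hX, hXs0]; ring
  have hQ0 : constantCoeff cQ = 1 := by
    rw [hQ]; simp only [map_sub, map_mul, map_pow, constantCoeff_C, hX, hXs0]; ring
  refine ⟨hU0, hQ0, ?_⟩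
  rw [hD]; simp only [map_add, map_sub, map_mul, map_pow, constantCoeff_C, hX, hXs0, hU0, hQ0]; ring

/-! ## §2 Congruences modulo `2` (`δ = −(1 + 4ν)g₂`) -/

section ModTwo

variable (I : Ideal K)

/-- In `(K/I)⟦z⟧` with `2 ∈ I`: `X₀ ↦ −1`. [folklore] -/
theorem frob_mk_X0 (hI : (2 : K) ∈ I) (hX0 : X0 = -1 - 4 * B2 - 64 * g2) : Ideal.Quotient.mk I X0 = -1 := by
  have h2 : Ideal.Quotient.mk I 2 = 0 := Ideal.Quotient.eq_zero_iff_mem.mpr hI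
  rw [hX0, map_sub, map_sub, map_neg, map_one, map_mul, map_mul,
    show (4 : K) = 2 * 2 by norm_num, show (64 : K) = 2 * 32 by norm_num, map_mul, map_mul, h2]
  ring

/-- In `(K/I)⟦z⟧` with `2 ∈ I`: `δ = −(1 + 4ν)g₂ ↦ −g₂`. [folklore] -/
theorem frob_mk_d (hI : (2 : K) ∈ I) (hd : d = -(1 + 4 * nu) * g2) : Ideal.Quotient.mk I d = -Ideal.Quotient.mk I g2 := by
  have h2 : Ideal.Quotient.mk I 2 = 0 := Ideal.Quotient.eq_zero_iff_mem.mpr hI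
  rw [hd, map_mul, map_neg, map_add, map_one, map_mul, show (4 : K) = 2 * 2 by norm_num, map_mul, h2]
  ring

/-- The curve equation in `(K/I)⟦z⟧`: `Xq² = Xq³ + zXq² + b₂z²Xq² + c₂z⁶` with `b₂, c₂` the images of `B₂, g₂`. [cite: SilvermanAEC2009, IV.1.1] -/
theorem frob_curve_eq_mk (hI : (2 : K) ∈ I) (h1 : V.a₁ = 1) (h2 : V.a₂ = B2) (h3 : V.a₃ = 0) (h4 : V.a₄ = 0) (h6 : V.a₆ = g2 * X0 ^ 2)
    (hX0 : X0 = -1 - 4 * B2 - 64 * g2) :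
    PowerSeries.map (Ideal.Quotient.mk I) V.formalXMulSq ^ 2 =
      PowerSeries.map (Ideal.Quotient.mk I) V.formalXMulSq ^ 3 + X * PowerSeries.map (Ideal.Quotient.mk I) V.formalXMulSq ^ 2 +
        C (Ideal.Quotient.mk I B2) * X ^ 2 * PowerSeries.map (Ideal.Quotient.mk I) V.formalXMulSq ^ 2 +
        C (Ideal.Quotient.mk I g2) * X ^ 6 := by
  have h := congrArg (PowerSeries.map (Ideal.Quotient.mk I)) (frob_curve_eq V h1 h2 h3 h4 h6)
  simp only [map_add, map_mul, map_pow, map_C, map_X, frob_mk_X0 I hI hX0, map_neg, map_one] at h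
  linear_combination h

/-- **`𝒰 ≡ Xs² (mod 2)`.** [cite: BlakestadGrant2023, Prop. 7] -/
theorem frob_map_calU (hI : (2 : K) ∈ I) (hX0 : X0 = -1 - 4 * B2 - 64 * g2) (hd : d = -(1 + 4 * nu) * g2)
    (hU : cU = V.formalXMulSq ^ 2 - 8 * C d * V.formalXMulSq * X ^ 2 + 2 * (C d * C X0 - 4 * C g2 * C X0) * X ^ 4) :
    PowerSeries.map (Ideal.Quotient.mk I) cU = PowerSeries.map (Ideal.Quotient.mk I) V.formalXMulSq ^ 2 := by
  have h2Q : (2 : (K ⧸ I)⟦X⟧) = 0 := by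
    rw [show (2 : (K ⧸ I)⟦X⟧) = C (Ideal.Quotient.mk I 2) by rw [map_ofNat, map_ofNat],
      Ideal.Quotient.eq_zero_iff_mem.mpr hI, map_zero]
  set Xq := PowerSeries.map (Ideal.Quotient.mk I) V.formalXMulSq with hXq
  set b2 := Ideal.Quotient.mk I B2 with hb2
  set c2 := Ideal.Quotient.mk I g2 with hc2
  rw [hU]
  simp only [map_add, map_sub, map_mul, map_pow, map_C, map_X, map_ofNat, map_neg, map_one, frob_mk_X0 I hI hX0,
    frob_mk_d I hI hd]
  rw [← hXq, ← hc2]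
  linear_combination ((5 : (K ⧸ I)⟦X⟧) * X ^ 4 * C c2 + (4 : (K ⧸ I)⟦X⟧) * Xq * X ^ 2 * C c2) * h2Q

/-- **`𝒬 ≡ Xs² (mod 2)`.** [cite: BlakestadGrant2023, Prop. 7] -/
theorem frob_map_calQ (hI : (2 : K) ∈ I) (hX0 : X0 = -1 - 4 * B2 - 64 * g2)
    (hQ : cQ = V.formalXMulSq ^ 2 - 16 * C g2 * V.formalXMulSq * X ^ 2 - 4 * C g2 * C X0 * X ^ 4) :
    PowerSeries.map (Ideal.Quotient.mk I) cQ = PowerSeries.map (Ideal.Quotient.mk I) V.formalXMulSq ^ 2 := by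
  have h2Q : (2 : (K ⧸ I)⟦X⟧) = 0 := by
    rw [show (2 : (K ⧸ I)⟦X⟧) = C (Ideal.Quotient.mk I 2) by rw [map_ofNat, map_ofNat],
      Ideal.Quotient.eq_zero_iff_mem.mpr hI, map_zero]
  set Xq := PowerSeries.map (Ideal.Quotient.mk I) V.formalXMulSq with hXq
  set c2 := Ideal.Quotient.mk I g2 with hc2
  rw [hQ]
  simp only [map_sub, map_mul, map_pow, map_C, map_X, map_ofNat, map_neg, map_one, frob_mk_X0 I hI hX0]
  rw [← hXq, ← hc2]
  linear_combination ((2 : (K ⧸ I)⟦X⟧) * X ^ 4 * C c2 + (-8 : (K ⧸ I)⟦X⟧) * Xq * X ^ 2 * C c2) * h2Q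

/-- **`𝔇 ≡ Xs³ (mod 2)`** (uses the curve equation and `c₁ ≡ B₆`, i.e. `δ ≡ g₂ (mod 2)`). [cite: BlakestadGrant2023, Prop. 7] -/
theorem frob_map_calD (hI : (2 : K) ∈ I) (h1 : V.a₁ = 1) (h2 : V.a₂ = B2) (h3 : V.a₃ = 0) (h4 : V.a₄ = 0) (h6 : V.a₆ = g2 * X0 ^ 2)
    (hX0 : X0 = -1 - 4 * B2 - 64 * g2) (hd : d = -(1 + 4 * nu) * g2)
    (hU : cU = V.formalXMulSq ^ 2 - 8 * C d * V.formalXMulSq * X ^ 2 + 2 * (C d * C X0 - 4 * C g2 * C X0) * X ^ 4)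
    (hQ : cQ = V.formalXMulSq ^ 2 - 16 * C g2 * V.formalXMulSq * X ^ 2 - 4 * C g2 * C X0 * X ^ 4)
    (hG : cG = (-C B2 - 32 * C g2) * V.formalXMulSq ^ 2 - 4 * (1 + 2 * C B2) * C d * V.formalXMulSq * X ^ 2 +
        (1 + 2 * C B2) * (C d * C X0 - 4 * C g2 * C X0) * X ^ 4 - 8 * C g2 * C X0 * V.formalXMulSq * X ^ 2 -
        2 * C g2 * C X0 ^ 2 * X ^ 4)
    (hD : cD = (1 + 2 * C B2) * X * V.formalXMulSq * cU + V.formalXMulSq ^ 2 * cQ + 8 * C g2 * C X0 * X ^ 4 * cQ -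
        X ^ 2 * V.formalXMulSq * cG) :
    PowerSeries.map (Ideal.Quotient.mk I) cD = PowerSeries.map (Ideal.Quotient.mk I) V.formalXMulSq ^ 3 := by
  have h2Q : (2 : (K ⧸ I)⟦X⟧) = 0 := by
    rw [show (2 : (K ⧸ I)⟦X⟧) = C (Ideal.Quotient.mk I 2) by rw [map_ofNat, map_ofNat],
      Ideal.Quotient.eq_zero_iff_mem.mpr hI, map_zero]
  have hcurveQ := frob_curve_eq_mk V I hI h1 h2 h3 h4 h6 hX0
  set Xq := PowerSeries.map (Ideal.Quotient.mk I) V.formalXMulSq with hXq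
  set b2 := Ideal.Quotient.mk I B2 with hb2
  set c2 := Ideal.Quotient.mk I g2 with hc2
  rw [hD, hU, hQ, hG]
  simp only [map_add, map_sub, map_mul, map_pow, map_neg, map_C, map_X, map_ofNat, map_one, frob_mk_X0 I hI hX0, frob_mk_d I hI hd]
  rw [← hXq, ← hb2, ← hc2]
  linear_combination ((-16 : (K ⧸ I)⟦X⟧) * X ^ 2 * C c2 + (-2 : (K ⧸ I)⟦X⟧) * X * C b2 + (-1 : (K ⧸ I)⟦X⟧) * Xq) * hcurveQ + ((-24 : (K ⧸ I)⟦X⟧) * X ^ 8 * C c2 ^ 2 + (-1 : (K ⧸ I)⟦X⟧) * X ^ 7 * C b2 * C c2 + (64 : (K ⧸ I)⟦X⟧) * Xq * X ^ 6 * C c2 ^ 2 + (-5 : (K ⧸ I)⟦X⟧) * Xq * X ^ 6 * C b2 * C c2 + (10 : (K ⧸ I)⟦X⟧) * Xq * X ^ 5 * C b2 * C c2 + (-2 : (K ⧸ I)⟦X⟧) * Xq * X ^ 6 * C c2 + (-12 : (K ⧸ I)⟦X⟧) * Xq ^ 2 * X ^ 4 * C b2 * C c2 + (5 : (K ⧸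 I)⟦X⟧) * Xq * X ^ 5 * C c2 + (8 : (K ⧸ I)⟦X⟧) * Xq ^ 2 * X ^ 3 * C b2 * C c2 + (-1 : (K ⧸ I)⟦X⟧) * Xq ^ 2 * X ^ 3 * C b2 ^ 2 + (-8 : (K ⧸ I)⟦X⟧) * Xq ^ 2 * X ^ 4 * C c2 + (-4 : (K ⧸ I)⟦X⟧) * Xq ^ 2 * X ^ 3 * C c2 + (8 : (K ⧸ I)⟦X⟧) * Xq ^ 2 * X ^ 2 * C c2 + (-1 : (K ⧸ I)⟦X⟧) * Xq ^ 2 * X ^ 2 * C b2 + Xq ^ 2 * X * C b2) * h2Q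

/-- Coefficients of a series are all in `I` iff its image in `(K/I)⟦z⟧` vanishes. [folklore] -/
theorem coeff_mem_of_map_mk_eq_zero {f : K⟦X⟧} (h : PowerSeries.map (Ideal.Quotient.mk I) f = 0) (n : ℕ) : coeff n f ∈ I := by
  have := congrArg (coeff n) h
  rw [coeff_map, map_zero] at this
  exact Ideal.Quotient.eq_zero_iff_mem.mp this

/-- **`T ≡ z² (mod 2)`, numerator form: every coefficient of `N₂ − z²·𝔇`, `N₂ = (1 + 2B₂)·z·(2 − z)·Xs·𝒰`, lies in any ideal containing `2`**
(with `T·𝔇 = N₂`, `…FrobeniusModel.lean`, and `𝔇` a unit this is the Frobenius-lift hypothesis `hφ` of the tree's Dwork lemma).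
[cite: BlakestadGrant2023, Prop. 7] -/
theorem frob_coeff_N2_sub_mem (hI : (2 : K) ∈ I) (h1 : V.a₁ = 1) (h2 : V.a₂ = B2) (h3 : V.a₃ = 0) (h4 : V.a₄ = 0) (h6 : V.a₆ = g2 * X0 ^ 2)
    (hX0 : X0 = -1 - 4 * B2 - 64 * g2) (hd : d = -(1 + 4 * nu) * g2)
    (hU : cU = V.formalXMulSq ^ 2 - 8 * C d * V.formalXMulSq * X ^ 2 + 2 * (C d * C X0 - 4 * C g2 * C X0) * X ^ 4)
    (hQ : cQ = V.formalXMulSq ^ 2 - 16 * C g2 * V.formalXMulSq * X ^ 2 - 4 * C g2 * C X0 * X ^ 4)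
    (hG : cG = (-C B2 - 32 * C g2) * V.formalXMulSq ^ 2 - 4 * (1 + 2 * C B2) * C d * V.formalXMulSq * X ^ 2 +
        (1 + 2 * C B2) * (C d * C X0 - 4 * C g2 * C X0) * X ^ 4 - 8 * C g2 * C X0 * V.formalXMulSq * X ^ 2 -
        2 * C g2 * C X0 ^ 2 * X ^ 4)
    (hD : cD = (1 + 2 * C B2) * X * V.formalXMulSq * cU + V.formalXMulSq ^ 2 * cQ + 8 * C g2 * C X0 * X ^ 4 * cQ -
        X ^ 2 * V.formalXMulSq * cG) (n : ℕ) :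
    coeff n ((1 + 2 * C B2) * X * (2 - X) * V.formalXMulSq * cU - X ^ 2 * cD) ∈ I := by
  refine coeff_mem_of_map_mk_eq_zero I ?_ n
  have h2Q : (2 : (K ⧸ I)⟦X⟧) = 0 := by
    rw [show (2 : (K ⧸ I)⟦X⟧) = C (Ideal.Quotient.mk I 2) by rw [map_ofNat, map_ofNat],
      Ideal.Quotient.eq_zero_iff_mem.mpr hI, map_zero]
  have hUq := frob_map_calU V I hI hX0 hd hU
  have hDq := frob_map_calD V I hI h1 h2 h3 h4 h6 hX0 hd hU hQ hG hD
  simp only [map_add, map_sub, map_mul, map_pow, map_C, map_X, map_ofNat, map_one, hUq, hDq]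
  set Xq := PowerSeries.map (Ideal.Quotient.mk I) V.formalXMulSq with hXq
  linear_combination (X * Xq ^ 3 - X ^ 2 * Xq ^ 3 + 2 * C (Ideal.Quotient.mk I B2) * X * Xq ^ 3 -
    C (Ideal.Quotient.mk I B2) * X ^ 2 * Xq ^ 3) * h2Q

/-- **`V ≡ 1 (mod 2)`, numerator form: every coefficient of `𝔇² − 𝒬·𝒰²` lies in any ideal containing `2`** (with `V = 𝔇²/(𝒬𝒰²)` this is the
hypothesis `hu` of the tree's Dwork lemma). [cite: BlakestadGrant2023, Prop. 7] -/
theorem frob_coeff_calD_sq_sub_mem (hI : (2 : K) ∈ I) (h1 : V.a₁ = 1) (h2 : V.a₂ = B2) (h3 : V.a₃ = 0) (h4 : V.a₄ = 0) (h6 : V.a₆ = g2 * X0 ^ 2)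
    (hX0 : X0 = -1 - 4 * B2 - 64 * g2) (hd : d = -(1 + 4 * nu) * g2)
    (hU : cU = V.formalXMulSq ^ 2 - 8 * C d * V.formalXMulSq * X ^ 2 + 2 * (C d * C X0 - 4 * C g2 * C X0) * X ^ 4)
    (hQ : cQ = V.formalXMulSq ^ 2 - 16 * C g2 * V.formalXMulSq * X ^ 2 - 4 * C g2 * C X0 * X ^ 4)
    (hG : cG = (-C B2 - 32 * C g2) * V.formalXMulSq ^ 2 - 4 * (1 + 2 * C B2) * C d * V.formalXMulSq * X ^ 2 +
        (1 + 2 * C B2) * (C d * C X0 - 4 * C g2 * C X0) * X ^ 4 - 8 * C g2 * C X0 * V.formalXMulSq * X ^ 2 -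
        2 * C g2 * C X0 ^ 2 * X ^ 4)
    (hD : cD = (1 + 2 * C B2) * X * V.formalXMulSq * cU + V.formalXMulSq ^ 2 * cQ + 8 * C g2 * C X0 * X ^ 4 * cQ -
        X ^ 2 * V.formalXMulSq * cG) (n : ℕ) :
    coeff n (cD ^ 2 - cQ * cU ^ 2) ∈ I := by
  refine coeff_mem_of_map_mk_eq_zero I ?_ n
  have hUq := frob_map_calU V I hI hX0 hd hU
  have hQq := frob_map_calQ V I hI hX0 hQ
  have hDq := frob_map_calD V I hI h1 h2 h3 h4 h6 hX0 hd hU hQ hG hD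
  simp only [map_sub, map_mul, map_pow, hUq, hQq, hDq]
  ring

end ModTwo

end FrobeniusSeries

end Summit.BirchSwinnertonDyer.BirchSwinnertonDyer.Theorems.AlignedTransportAtTwoSigmaSqTwo
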